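import Summits.FinalStateConjecture.FinalStateConjecture.Theorems.ClusterCompletenessRecurrentlyFlatDispersesFutureSetCone
import Literature.Geometry.Lorentzian.CausalCurveLengthBound
import Literature.Geometry.Lorentzian.TimelikeRayCauchy
import Literature.Geometry.Lorentzian.CausalFutureProofs
import Literature.Geometry.Lorentzian.CauchyDevelopmentGlobalHyperbolicityProofs

/-!
# Crux `RecurrentlyFlatDisperses` (stmt-FinalStateConjecture-14665), line `Sketch`
# (card `outgoing-blind-cup-restart`) — stub `stub_futureSet`, part 2: the first-exit argument

Support file (2 of 3) for the registered stub `stub_futureSet`. For a smooth injective local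
diffeomorphism `Φ : V → 𝓢` on the late half-space `V = {x⁰ > τ₀} ⊆ E4` satisfying the cone
estimate of part 1, with `g(dΦ ∂₀, dΦ ∂₀) ≤ −3/4`, `dΦ ∂₀` future-directed, open range
`W = Φ(V) ⊆ J⁺(S)`, all `J⁻(q) ∩ J⁺(S)` compact and the spacetime strongly causal, a future
timelike curve `γ : [a, b] → 𝓢` starting in `W` stays in `W` (`forall_mem_range`). At the first
exit parameter `σ` (attained: `W` open, `γ` continuous) two cases are excluded:

* chart time of the lift bounded on `[a, σ)` (`mem_range_of_bddAbove`): the coordinate lift is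
  Cauchy as `s ↑ σ` (displacement `≤ 2 ×` increase of chart time), converges in `V`, and its image
  converges both to `Φ` of the limit and to `γ σ` — Hausdorff, so `γ σ ∈ W`;
* chart time unbounded (`bddAbove_of_exit`): the anchored vertical rays `r ↦ Φ(y + δ(eʳ − 1)∂₀)`
  below `γ t`, `δ = y⁰ − τ₀`, are future causal curves of speed `≥ 1/2` inside the compact
  `J⁻(γ σ) ∩ J⁺(S)` (transitivity `causalFuture_causalFuture_eq`, O'Neill 1983, Ch. 14, p. 402) of
  length `≥ (log δ)/2 → ∞` (`PseudoRiemannianMetric.ofReal_mul_le_arcLength`), against the uniform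
  bound `IsStronglyCausal.exists_arcLength_le_of_isCompact` (O'Neill 1983, Ch. 14, Lemma 14.14).

The vertical-ray lemmas are copied from the landed neighbour `stub_chartFuture`. Mathlib + the
Literature cone only; no definitions, no named facts.
-/

noncomputable section

open scoped Manifold ContDiff Topology
open Bundle Filter Set Function TopologicalSpace Literature.Geometry.Lorentzian

namespace Summit.FinalStateConjecture.FinalStateConjecture.Theorems.RecurrentlyFlatDisperses

namespace FutureSet

/-! ### The vertical exponential ray of the chart (copied from the neighbour `stub_chartFuture`) -/

/-- `2 ≤ ∞` in `ℕ∞ω` (regularity side condition of the causality theorems). -/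
private lemma two_le_infty : (2 : ℕ∞ω) ≤ ∞ := WithTop.coe_le_coe.mpr le_top

/-- `1 ≤ ∞` in `ℕ∞ω`. -/
private lemma one_le_infty : (1 : ℕ∞ω) ≤ ∞ := WithTop.coe_le_coe.mpr le_top

/-- The chart-vertical curve `s ↦ x₀ + δ(eˢ - 1) ∂₀` of `E4` has derivative `δ eᵗ ∂₀` at `t`. -/
private theorem hasDerivAt_vert (x₀ : E4) (δ t : ℝ) :
    HasDerivAt (fun s : ℝ ↦ x₀ + (δ * (Real.exp s - 1)) • (E4.basisVector 0 : E4))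
      ((δ * Real.exp t) • (E4.basisVector 0 : E4)) t := by
  have h1 : HasDerivAt (fun s : ℝ ↦ δ * (Real.exp s - 1)) (δ * Real.exp t) t := by
    simpa using ((Real.hasDerivAt_exp t).sub_const 1).const_mul δ
  simpa using (h1.smul_const (E4.basisVector 0 : E4)).const_add x₀

/-- The time coordinate along the chart-vertical curve is `x₀⁰ + δ(eˢ - 1)`. -/
private theorem vert_apply_zero (x₀ : E4) (δ s : ℝ) :
    (x₀ + (δ * (Real.exp s - 1)) • (E4.basisVector 0 : E4)) 0 = x₀ 0 + δ * (Real.exp s - 1) := by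
  simp [E4.basisVector]

/-- The chart-vertical curve is smooth (as a map `ℝ → E4`). -/
private theorem contDiff_vert (x₀ : E4) (δ : ℝ) :
    ContDiff ℝ ∞ (fun s : ℝ ↦ x₀ + (δ * (Real.exp s - 1)) • (E4.basisVector 0 : E4)) :=
  contDiff_const.add ((contDiff_const.mul (Real.contDiff_exp.sub contDiff_const)).smul
    contDiff_const)

/-- The velocity of the chart-vertical curve (as a curve in the manifold `E4`) is `δ eᵗ ∂₀`. -/
private theorem velocity_vert (x₀ : E4) (δ t : ℝ) :
    velocity 𝓘(ℝ, E4) (fun s : ℝ ↦ x₀ + (δ * (Real.exp s - 1)) • (E4.basisVector 0 : E4)) t =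
      (δ * Real.exp t) • (E4.basisVector 0 : E4) := by
  simp only [velocity]
  rw [mfderiv_eq_fderiv, ← toSpanSingleton_deriv, (hasDerivAt_vert x₀ δ t).deriv]
  exact one_smul ℝ _

/-- `B(a • w, a • w) = a² B(w, w)` for the metric at a point. -/
private theorem val_smul_smul {E : Type*} [NormedAddCommGroup E] [NormedSpace ℝ E] {H : Type*}
    [TopologicalSpace H] {I : ModelWithCorners ℝ E H} {n : ℕ∞ω} {M : Type*} [TopologicalSpace M]
    [ChartedSpace H M] [IsManifold I ∞ M] (g : LorentzianMetric I n M) (x : M) (a : ℝ)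
    (w : TangentSpace I x) : g.val x (a • w) (a • w) = a * a * g.val x w w := by
  rw [map_smul, map_smul, smul_apply, smul_eq_mul, smul_eq_mul, mul_assoc]

/-- Chain rule for velocities: `(f ∘ γ)'(t) = df_{γ t}(γ' t)`. -/
private theorem velocity_comp' {E' : Type*} [NormedAddCommGroup E'] [NormedSpace ℝ E']
    {H' : Type*} [TopologicalSpace H'] {I' : ModelWithCorners ℝ E' H'} {N : Type*}
    [TopologicalSpace N] [ChartedSpace H' N]
    {E : Type*} [NormedAddCommGroup E] [NormedSpace ℝ E] {H : Type*} [TopologicalSpace H]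
    {I : ModelWithCorners ℝ E H} {M : Type*} [TopologicalSpace M] [ChartedSpace H M]
    {f : N → M} {γ : ℝ → N} {t : ℝ} (hf : MDifferentiableAt I' I f (γ t))
    (hγ : MDifferentiableAt 𝓘(ℝ, ℝ) I' γ t) :
    velocity I (f ∘ γ) t = mfderiv I' I f (γ t) (velocity I' γ t) := by
  simp only [velocity]
  rw [mfderiv_comp t hf hγ]
  rfl

/-- **The lifted vertical ray and its velocity.** For a smooth chart map `Ψ : U₀ → 𝓢` and a curve
`c : ℝ → U₀` whose underlying `E4`-curve is the chart-vertical curve `s ↦ x₀ + δ(eˢ - 1) ∂₀`, the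
lift `Ψ ∘ c` is smooth and its velocity at `t` is `δ eᵗ · dΨ_{c t}(∂₀)`. -/
private theorem vertical_lift {𝓢 : Spacetime 4} {U₀ : Opens E4} {Ψ : U₀ → 𝓢.carrier}
    (hΨ : ContMDiff 𝓘(ℝ, E4) (𝓡 4) ∞ Ψ) (x₀ : E4) (δ : ℝ) {c : ℝ → U₀}
    (hc : ∀ s : ℝ, (c s : E4) = x₀ + (δ * (Real.exp s - 1)) • (E4.basisVector 0 : E4)) :
    ContMDiff 𝓘(ℝ, ℝ) (𝓡 4) ∞ (Ψ ∘ c) ∧ ∀ t : ℝ, MDifferentiableAt 𝓘(ℝ, ℝ) (𝓡 4) (Ψ ∘ c) t ∧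
      velocity (𝓡 4) (Ψ ∘ c) t =
        (δ * Real.exp t) • mfderiv 𝓘(ℝ, E4) (𝓡 4) Ψ (c t) (E4.basisVector 0) := by
  have hcv :
      Subtype.val ∘ c = (fun s : ℝ ↦ x₀ + (δ * (Real.exp s - 1)) • (E4.basisVector 0 : E4)) :=
    funext hc
  have hp_smooth : ContMDiff 𝓘(ℝ, ℝ) 𝓘(ℝ, E4) ∞
      (fun s : ℝ ↦ x₀ + (δ * (Real.exp s - 1)) • (E4.basisVector 0 : E4)) :=
    contMDiff_iff_contDiff.mpr (contDiff_vert x₀ δ)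
  have hc_smooth : ContMDiff 𝓘(ℝ, ℝ) 𝓘(ℝ, E4) ∞ c :=
    (ContMDiff.subtypeVal_comp_iff U₀ c).mp (hcv ▸ hp_smooth)
  have hγ : ContMDiff 𝓘(ℝ, ℝ) (𝓡 4) ∞ (Ψ ∘ c) := hΨ.comp hc_smooth
  refine ⟨hγ, fun t ↦ ⟨hγ.mdifferentiableAt (by simp), ?_⟩⟩
  have hct : MDifferentiableAt 𝓘(ℝ, ℝ) 𝓘(ℝ, E4) c t := hc_smooth.mdifferentiableAt (by simp)
  have hΨt : MDifferentiableAt 𝓘(ℝ, E4) (𝓡 4) Ψ (c t) := hΨ.mdifferentiableAt (by simp)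
  have hvc : velocity 𝓘(ℝ, E4) c t = (δ * Real.exp t) • (E4.basisVector 0 : E4) := by
    have h1 : velocity 𝓘(ℝ, E4) (Subtype.val ∘ c) t =
        mfderiv 𝓘(ℝ, E4) 𝓘(ℝ, E4) (Subtype.val : U₀ → E4) (c t) (velocity 𝓘(ℝ, E4) c t) :=
      velocity_comp' (hasMFDerivAt_subtypeVal (c t)).mdifferentiableAt hct
    rw [mfderiv_subtypeVal, hcv, velocity_vert] at h1
    exact h1.symm
  rw [velocity_comp' hΨt hct, hvc]
  exact (mfderiv 𝓘(ℝ, E4) (𝓡 4) Ψ (c t)).map_smul (δ * Real.exp t) (E4.basisVector 0)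

/-! ### The first-exit argument: the two cases -/

/-- **Unbounded chart time before the exit parameter is impossible.** Setting: `Φ : V → 𝓢` a smooth
chart on the late half-space `V = {x⁰ > τ₀}` with `g(dΦ ∂₀, dΦ ∂₀) ≤ -3/4` and `dΦ ∂₀`
future-directed, whose range lies in `J⁺(S)` with all `J⁻(q) ∩ J⁺(S)` compact, in a strongly causal
spacetime; `γ` a future causal curve on `[a, b]` with `γ([a, σ)) ⊆ Φ(V)`, `a < σ ≤ b`. Then the
chart time of `Φ⁻¹ ∘ γ` is bounded above on `[a, σ)`: otherwise the vertical rays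
`r ↦ Φ(y + δ(eʳ - 1)∂₀)`, `r ∈ [-log δ, 0]`, `y = Φ⁻¹(γ t)`, `δ = y⁰ - τ₀`, are future causal
curves of speed `≥ 1/2` inside the compact `J⁻(γ σ) ∩ J⁺(S)` (below `γ t ≤ γ σ`, O'Neill 1983,
Ch. 14, p. 402, transitivity `causalFuture_causalFuture_eq`), of length `≥ (log δ)/2 → ∞`
(`PseudoRiemannianMetric.ofReal_mul_le_arcLength`), against the uniform bound of
`IsStronglyCausal.exists_arcLength_le_of_isCompact` (O'Neill 1983, Ch. 14, Lemma 14.14). -/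
private theorem bddAbove_of_exit {𝓢 : Spacetime 4} {V : Opens E4} [Nonempty V]
    {Φ : V → 𝓢.carrier} {τ₀ : ℝ} (hΦs : ContMDiff 𝓘(ℝ, E4) (𝓡 4) ∞ Φ)
    (hVmem : ∀ p : E4, p ∈ V ↔ τ₀ < p 0)
    (hvert : ∀ x : V, 𝓢.metric.val (Φ x) (mfderiv 𝓘(ℝ, E4) (𝓡 4) Φ x (E4.basisVector 0))
        (mfderiv 𝓘(ℝ, E4) (𝓡 4) Φ x (E4.basisVector 0)) ≤ -(3 / 4) ∧
      𝓢.timeOrientation.IsFutureDirected (mfderiv 𝓘(ℝ, E4) (𝓡 4) Φ x (E4.basisVector 0)))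
    (hsc : 𝓢.metric.IsStronglyCausal 𝓢.timeOrientation) {S : Set 𝓢.carrier}
    (hK : ∀ q : 𝓢.carrier, IsCompact (𝓢.metric.causalPast 𝓢.timeOrientation {q} ∩
      𝓢.metric.causalFuture 𝓢.timeOrientation S))
    (hWS : range Φ ⊆ 𝓢.metric.causalFuture 𝓢.timeOrientation S)
    {γ : ℝ → 𝓢.carrier} {a σ b : ℝ} (hσb : σ ≤ b)
    (hγ : 𝓢.metric.IsFutureCausalCurveOn 𝓢.timeOrientation γ (Icc a b))
    (hW : ∀ t ∈ Ico a σ, γ t ∈ range Φ) :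
    BddAbove ((fun t ↦ ((Function.invFun Φ (γ t) : V) : E4) 0) '' Ico a σ) := by
  by_contra hunb
  set g := 𝓢.metric with hg
  set τ := 𝓢.timeOrientation with hτ
  -- the uniform length bound in the compact `J⁻(γ σ) ∩ J⁺(S)`
  obtain ⟨B, hBtop, hBle⟩ :=
    LorentzianMetric.IsStronglyCausal.exists_arcLength_le_of_isCompact τ one_le_infty hsc (hK (γ σ))
  set R : ℝ := B.toReal with hR
  have hR0 : 0 ≤ R := ENNReal.toReal_nonneg
  -- a parameter with very large chart time
  obtain ⟨_, ⟨t, htJ, rfl⟩, hft⟩ := not_bddAbove_iff.1 hunb (τ₀ + Real.exp (2 * R + 2))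
  set x : V := Function.invFun Φ (γ t) with hx
  set y : E4 := (x : E4) with hy
  have hft' : τ₀ + Real.exp (2 * R + 2) < y 0 := hft
  set δ : ℝ := y 0 - τ₀ with hδ
  have hexpδ : Real.exp (2 * R + 2) < δ := by rw [hδ]; linarith
  have hδ1 : 1 < δ := lt_trans (Real.one_lt_exp_iff.2 (by linarith)) hexpδ
  have hδpos : 0 < δ := lt_trans one_pos hδ1
  have hlogδ : 2 * R + 2 < Real.log δ := (Real.lt_log_iff_exp_lt hδpos).2 hexpδ
  have hlogpos : 0 < Real.log δ := Real.log_pos hδ1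
  have hΦx : Φ x = γ t := Function.invFun_eq (hW t htJ)
  -- the vertical ray below `γ t`
  have hpt : ∀ r : ℝ, τ₀ < (y + (δ * (Real.exp r - 1)) • (E4.basisVector 0 : E4)) 0 := by
    intro r
    rw [vert_apply_zero]
    have : 0 < δ * Real.exp r := mul_pos hδpos (Real.exp_pos r)
    rw [hδ] at this ⊢
    linarith
  set cV : ℝ → V := fun r ↦ ⟨y + (δ * (Real.exp r - 1)) • (E4.basisVector 0 : E4),
    (hVmem _).2 (hpt r)⟩ with hcV
  have hcVval : ∀ r : ℝ, (cV r : E4) = y + (δ * (Real.exp r - 1)) • (E4.basisVector 0 : E4) :=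
    fun r ↦ rfl
  have hcV0 : cV 0 = x := Subtype.ext (by simp [hcV, hy])
  obtain ⟨hαs, hvel⟩ := vertical_lift (𝓢 := 𝓢) hΦs y δ (c := cV) hcVval
  set α : ℝ → 𝓢.carrier := Φ ∘ cV with hαdef
  have hα0 : α 0 = γ t := by
    show Φ (cV 0) = γ t
    rw [hcV0, hΦx]
  -- speed and causal character of the ray
  have hval : ∀ r : ℝ, -Real.log δ ≤ r →
      g.val (α r) (velocity (𝓡 4) α r) (velocity (𝓡 4) α r) ≤ -(3 / 4) := by
    intro r hr
    have e : g.val (α r) (velocity (𝓡 4) α r) (velocity (𝓡 4) α r) =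
        δ * Real.exp r * (δ * Real.exp r) *
          g.val (Φ (cV r)) (mfderiv 𝓘(ℝ, E4) (𝓡 4) Φ (cV r) (E4.basisVector 0))
            (mfderiv 𝓘(ℝ, E4) (𝓡 4) Φ (cV r) (E4.basisVector 0)) := by
      rw [(hvel r).2]
      exact val_smul_smul g (α r) (δ * Real.exp r) _
    rw [e]
    have h1 := (hvert (cV r)).1
    have h2 : 1 ≤ δ * Real.exp r := by
      have h3 : Real.exp (-Real.log δ) ≤ Real.exp r := Real.exp_le_exp.2 hr
      rw [Real.exp_neg, Real.exp_log hδpos] at h3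
      calc (1 : ℝ) = δ * δ⁻¹ := (mul_inv_cancel₀ hδpos.ne').symm
        _ ≤ δ * Real.exp r := mul_le_mul_of_nonneg_left h3 hδpos.le
    have h4 : 1 ≤ δ * Real.exp r * (δ * Real.exp r) := by nlinarith
    have h5 : δ * Real.exp r * (δ * Real.exp r) *
        g.val (Φ (cV r)) (mfderiv 𝓘(ℝ, E4) (𝓡 4) Φ (cV r) (E4.basisVector 0))
          (mfderiv 𝓘(ℝ, E4) (𝓡 4) Φ (cV r) (E4.basisVector 0)) ≤
        δ * Real.exp r * (δ * Real.exp r) * (-(3 / 4)) :=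
      mul_le_mul_of_nonneg_left h1 (by positivity)
    nlinarith [h4, h5]
  have hfd : ∀ r : ℝ, τ.IsFutureDirected (velocity (𝓡 4) α r) := by
    intro r
    rw [(hvel r).2]
    exact (hvert (cV r)).2.smul (mul_pos hδpos (Real.exp_pos r))
  have hcurve : g.IsFutureCausalCurveOn τ α (Icc (-Real.log δ) 0) := fun r _ ↦
    ⟨(hvel r).1, hfd r⟩
  have hspeed : ∀ r ∈ Icc (-Real.log δ) 0, (1 / 2 : ℝ) ≤ g.speed α r := by
    intro r hr
    have h1 := hval r hr.1
    rw [PseudoRiemannianMetric.speed_eq_sqrt_neg_of_nonpos (by linarith)]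
    refine (Real.le_sqrt' (by norm_num)).2 ?_
    linarith
  -- the ray lies in `J⁻(γ σ) ∩ J⁺(S)`
  have hγσ : γ σ ∈ g.causalFuture τ {γ t} :=
    Or.inr ⟨γ t, rfl, γ, t, σ, htJ.2, hγ.mono (Icc_subset_Icc htJ.1 hσb), rfl, rfl⟩
  have hcontain : ∀ r ∈ Icc (-Real.log δ) 0,
      α r ∈ g.causalPast τ {γ σ} ∩ g.causalFuture τ S := by
    intro r hr
    refine ⟨?_, hWS ⟨cV r, rfl⟩⟩
    refine LorentzianMetric.mem_causalPast_singleton_iff.2 ?_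
    have h2 : γ t ∈ g.causalFuture τ {α r} := by
      rcases eq_or_lt_of_le hr.2 with h0 | h0
      · rw [h0, hα0]
        exact LorentzianMetric.subset_causalFuture g τ _ (mem_singleton _)
      · exact Or.inr ⟨α r, rfl, α, r, 0, h0, hcurve.mono (Icc_subset_Icc hr.1 le_rfl), rfl, hα0⟩
    have h3 := LorentzianMetric.causalFuture_mono (singleton_subset_iff.2 h2) hγσ
    rwa [LorentzianMetric.causalFuture_causalFuture_eq two_le_infty] at h3
  -- length comparison
  have hlen : ENNReal.ofReal (1 / 2 * (0 - -Real.log δ)) ≤ g.arcLength α (-Real.log δ) 0 :=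
    PseudoRiemannianMetric.ofReal_mul_le_arcLength (by norm_num) hspeed
  have hle : g.arcLength α (-Real.log δ) 0 ≤ B :=
    hBle α (-Real.log δ) 0 (by linarith) hcurve hcontain
  have hfin : ENNReal.ofReal (1 / 2 * (0 - -Real.log δ)) ≤ ENNReal.ofReal R := by
    rw [hR, ENNReal.ofReal_toReal hBtop.ne]
    exact hlen.trans hle
  have := (ENNReal.ofReal_le_ofReal_iff hR0).1 hfin
  linarith

/-- **Bounded chart time before the exit parameter makes the exit point charted.** With `Φ` an
injective local diffeomorphism on `V = {x⁰ > τ₀}` satisfying the cone estimate, `γ` future timelike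
on `[a, σ)` inside `Φ(V)`, `a < σ`, continuous at `σ`, and the chart time of `Φ⁻¹ ∘ γ` bounded on
`[a, σ)`: the coordinate lift is Cauchy as `s ↑ σ` (`‖c s₂ - c s₁‖ ≤ 2 (c⁰ s₂ - c⁰ s₁)` with `c⁰`
increasing and bounded), so it converges to a point of `V` (its time is `≥ c⁰(a) > τ₀`), whose image
is the limit `γ σ` (Hausdorff); hence `γ σ ∈ Φ(V)`. -/
private theorem mem_range_of_bddAbove {𝓢 : Spacetime 4} {V : Opens E4} [Nonempty V]
    {Φ : V → 𝓢.carrier} {τ₀ : ℝ} (hΦs : ContMDiff 𝓘(ℝ, E4) (𝓡 4) ∞ Φ) (hinj : Injective Φ)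
    (hloc : IsLocalDiffeomorph 𝓘(ℝ, E4) (𝓡 4) ∞ Φ)
    (hcone : ∀ (x : V) (w : E4), 𝓢.metric.IsTimelike (mfderiv 𝓘(ℝ, E4) (𝓡 4) Φ x w) →
      𝓢.timeOrientation.IsFutureDirected (mfderiv 𝓘(ℝ, E4) (𝓡 4) Φ x w) →
      0 < w 0 ∧ ‖w‖ < 2 * w 0)
    (hVmem : ∀ p : E4, p ∈ V ↔ τ₀ < p 0)
    {γ : ℝ → 𝓢.carrier} {a σ : ℝ} (haσ : a < σ)
    (hγ : 𝓢.metric.IsFutureTimelikeCurveOn 𝓢.timeOrientation γ (Ico a σ))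
    (hW : ∀ t ∈ Ico a σ, γ t ∈ range Φ)
    (hbdd : BddAbove ((fun t ↦ ((Function.invFun Φ (γ t) : V) : E4) 0) '' Ico a σ))
    (hcont : ContinuousAt γ σ) : γ σ ∈ range Φ := by
  set c : ℝ → E4 := fun t ↦ ((Function.invFun Φ (γ t) : V) : E4) with hc
  have hcdef : c = Subtype.val ∘ Function.invFun Φ ∘ γ := rfl
  -- derivative and cone estimate along the lift
  have hder : ∀ t ∈ Ico a σ, HasDerivAt c (deriv c t) t ∧ 0 < deriv c t 0 ∧
      ‖deriv c t‖ < 2 * deriv c t 0 := fun t ht ↦ by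
    obtain ⟨hd, h1, h2⟩ := lift_cone hΦs hinj hloc hcone (hγ t ht) (hW t ht)
    exact ⟨hd.hasDerivAt, h1, h2⟩
  have hmono : StrictMonoOn (fun t ↦ c t 0) (Ico a σ) :=
    strictMonoOn_apply_zero (w := fun t ↦ deriv c t) (convex_Ico a σ)
      fun t ht ↦ ⟨(hder t ht).1, (hder t ht).2.1⟩
  have hdisp : ∀ s₁ s₂ : ℝ, a ≤ s₁ → s₁ ≤ s₂ → s₂ < σ →
      ‖c s₂ - c s₁‖ ≤ 2 * (c s₂ 0 - c s₁ 0) := fun s₁ s₂ h1 h12 h2 ↦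
    norm_sub_le_of_hasDerivAt (w := fun t ↦ deriv c t) h12 fun t ht ↦
      ⟨(hder t ⟨h1.trans ht.1, lt_of_le_of_lt ht.2 h2⟩).1,
        (hder t ⟨h1.trans ht.1, lt_of_le_of_lt ht.2 h2⟩).2.2.le⟩
  -- the lift is Cauchy at `σ⁻`
  set L : ℝ := sSup ((fun t ↦ c t 0) '' Ico a σ) with hL
  have hne : ((fun t ↦ c t 0) '' Ico a σ).Nonempty := ⟨c a 0, a, ⟨le_rfl, haσ⟩, rfl⟩
  have hfL : ∀ t ∈ Ico a σ, c t 0 ≤ L := fun t ht ↦ le_csSup hbdd ⟨t, ht, rfl⟩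
  have hcau : Cauchy (map c (𝓝[<] σ)) := by
    rw [Metric.cauchy_iff]
    refine ⟨inferInstance, fun ε hε ↦ ?_⟩
    obtain ⟨_, ⟨s₁, hs₁, rfl⟩, hLs₁⟩ := exists_lt_of_lt_csSup hne (show L - ε / 4 < L by linarith)
    refine ⟨c '' Ico s₁ σ, image_mem_map (Ico_mem_nhdsLT hs₁.2), ?_⟩
    rintro _ ⟨u, hu, rfl⟩ _ ⟨u', hu', rfl⟩
    have key : ∀ v v' : ℝ, v ∈ Ico s₁ σ → v' ∈ Ico s₁ σ → v ≤ v' → dist (c v) (c v') < ε := by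
      intro v v' hv hv' hvv'
      rw [dist_comm, dist_eq_norm]
      have h1 := hdisp v v' (hs₁.1.trans hv.1) hvv' hv'.2
      have h2 := hfL v' ⟨hs₁.1.trans hv'.1, hv'.2⟩
      have h3 : c s₁ 0 ≤ c v 0 := hmono.monotoneOn hs₁ ⟨hs₁.1.trans hv.1, hv.2⟩ hv.1
      have h4 : L - ε / 4 < c s₁ 0 := hLs₁
      linarith
    rcases le_total u u' with h | h
    · exact key u u' hu hu' h
    · rw [dist_comm]; exact key u' u hu' hu h
  obtain ⟨p, hp⟩ := CompleteSpace.complete hcau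
  have hp' : Tendsto c (𝓝[<] σ) (𝓝 p) := hp
  -- the limit point lies in `V`
  have hp0 : Tendsto (fun t ↦ c t 0) (𝓝[<] σ) (𝓝 (p 0)) :=
    ((PiLp.continuous_apply 2 (fun _ : Fin 4 ↦ ℝ) 0).tendsto p).comp hp'
  have hfa : ∀ᶠ t in 𝓝[<] σ, c a 0 ≤ c t 0 := by
    filter_upwards [Ico_mem_nhdsLT haσ] with t ht
    exact hmono.monotoneOn ⟨le_rfl, haσ⟩ ht ht.1
  have hpa : c a 0 ≤ p 0 := ge_of_tendsto hp0 hfa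
  have hca : τ₀ < c a 0 := (hVmem _).1 (Function.invFun Φ (γ a)).2
  have hpV : p ∈ V := (hVmem p).2 (lt_of_lt_of_le hca hpa)
  -- the images converge to `Φ` of the limit, and to `γ σ`
  have hz : Tendsto (fun t ↦ (Function.invFun Φ (γ t) : V)) (𝓝[<] σ) (𝓝 ⟨p, hpV⟩) :=
    tendsto_subtype_rng.2 hp'
  have hΦz : Tendsto (fun t ↦ Φ (Function.invFun Φ (γ t))) (𝓝[<] σ) (𝓝 (Φ ⟨p, hpV⟩)) :=
    (hΦs.continuous.tendsto _).comp hz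
  have heq : (fun t ↦ Φ (Function.invFun Φ (γ t))) =ᶠ[𝓝[<] σ] γ := by
    filter_upwards [Ico_mem_nhdsLT haσ] with t ht
    exact Function.invFun_eq (hW t ht)
  have hlim : Tendsto γ (𝓝[<] σ) (𝓝 (Φ ⟨p, hpV⟩)) := hΦz.congr' heq
  have hlim' : Tendsto γ (𝓝[<] σ) (𝓝 (γ σ)) := hcont.tendsto.mono_left nhdsWithin_le_nhds
  exact ⟨⟨p, hpV⟩, (tendsto_nhds_unique hlim' hlim).symm⟩

/-- **The chart image is not left by future timelike curves** (first-exit argument; registered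
sub-goal `forall_mem_range` of stub `stub_futureSet`). For `Φ` as above with open range, a future
timelike curve `γ` on `[a, b]` starting in `Φ(V)` stays in `Φ(V)`: at the first exit parameter
`σ = inf {s | γ s ∉ Φ(V)}` (`> a`, attained since `Φ(V)` is open and `γ` continuous) the chart time
before `σ` is bounded (`bddAbove_of_exit`), so `γ σ ∈ Φ(V)` (`mem_range_of_bddAbove`), a
contradiction. -/
theorem forall_mem_range : ∀ {𝓢 : Spacetime 4} {V : Opens E4} [Nonempty V] {Φ : V → 𝓢.carrier}
    {τ₀ : ℝ}, ContMDiff 𝓘(ℝ, E4) (𝓡 4) ∞ Φ → Function.Injective Φ →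
    IsLocalDiffeomorph 𝓘(ℝ, E4) (𝓡 4) ∞ Φ →
    (∀ (x : V) (w : E4), 𝓢.metric.IsTimelike (mfderiv 𝓘(ℝ, E4) (𝓡 4) Φ x w) →
      𝓢.timeOrientation.IsFutureDirected (mfderiv 𝓘(ℝ, E4) (𝓡 4) Φ x w) →
      0 < w 0 ∧ ‖w‖ < 2 * w 0) →
    (∀ p : E4, p ∈ V ↔ τ₀ < p 0) → IsOpen (Set.range Φ) →
    (∀ x : V, 𝓢.metric.val (Φ x) (mfderiv 𝓘(ℝ, E4) (𝓡 4) Φ x (E4.basisVector 0))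
        (mfderiv 𝓘(ℝ, E4) (𝓡 4) Φ x (E4.basisVector 0)) ≤ -(3 / 4) ∧
      𝓢.timeOrientation.IsFutureDirected (mfderiv 𝓘(ℝ, E4) (𝓡 4) Φ x (E4.basisVector 0))) →
    𝓢.metric.IsStronglyCausal 𝓢.timeOrientation →
    ∀ {S : Set 𝓢.carrier},
    (∀ q : 𝓢.carrier, IsCompact (𝓢.metric.causalPast 𝓢.timeOrientation {q} ∩
      𝓢.metric.causalFuture 𝓢.timeOrientation S)) →
    Set.range Φ ⊆ 𝓢.metric.causalFuture 𝓢.timeOrientation S →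
    ∀ {γ : ℝ → 𝓢.carrier} {a b : ℝ},
    𝓢.metric.IsFutureTimelikeCurveOn 𝓢.timeOrientation γ (Set.Icc a b) →
    γ a ∈ Set.range Φ → ∀ s ∈ Set.Icc a b, γ s ∈ Set.range Φ := by
  intro 𝓢 V _ Φ τ₀ hΦs hinj hloc hcone hVmem hWopen hvert hsc S hK hWS γ a b hγ ha s hs
  by_contra hsW
  set T : Set ℝ := Icc a b ∩ γ ⁻¹' (range Φ)ᶜ with hT
  have hTne : T.Nonempty := ⟨s, hs, hsW⟩
  have hTbdd : BddBelow T := ⟨a, fun u hu ↦ hu.1.1⟩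
  have hγcont : ContinuousOn γ (Icc a b) := fun u hu ↦ (hγ u hu).1.continuousAt.continuousWithinAt
  have hTclosed : IsClosed T :=
    hγcont.preimage_isClosed_of_isClosed isClosed_Icc hWopen.isClosed_compl
  set σ := sInf T with hσ
  have hmem : σ ∈ T := hTclosed.csInf_mem hTne hTbdd
  have hσab : σ ∈ Icc a b := hmem.1
  have hnot : γ σ ∉ range Φ := hmem.2
  have haσ : a < σ := lt_of_le_of_ne hσab.1 fun h ↦ hnot (h ▸ ha)
  have hbelow : ∀ u ∈ Ico a σ, γ u ∈ range Φ := fun u hu ↦ by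
    by_contra h
    have : σ ≤ u := csInf_le hTbdd ⟨⟨hu.1, hu.2.le.trans hσab.2⟩, h⟩
    exact absurd hu.2 (not_lt.2 this)
  have hγJ : 𝓢.metric.IsFutureTimelikeCurveOn 𝓢.timeOrientation γ (Ico a σ) :=
    hγ.mono fun u hu ↦ ⟨hu.1, hu.2.le.trans hσab.2⟩
  have hbdd := bddAbove_of_exit hΦs hVmem hvert hsc hK hWS hσab.2 hγ.isFutureCausalCurveOn hbelow
  exact hnot (mem_range_of_bddAbove hΦs hinj hloc hcone hVmem haσ hγJ hbelow hbdd
    (hγ σ hσab).1.continuousAt)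

end FutureSet

end Summit.FinalStateConjecture.FinalStateConjecture.Theorems.RecurrentlyFlatDisperses

end
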